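import Literature.MathematicalPhysics.QuantumLattice.FockMapOp
import Literature.MathematicalPhysics.QuantumLattice.PairCorrelationsD4Proofs
import Literature.MathematicalPhysics.QuantumLattice.PairCorrelationsDWaveSymmetryProofs
import HarnessLib

/-!
# The point group `D₄` of the square Hubbard torus, second-quantised: `Γ(γ) = fockMapOp (d4Orb γ)`

Topic `MathematicalPhysics/QuantumLattice`; completes the definition request `defn-fockMapOp` for
its actual use in route HubbardSuperconductivity/PositivityPins (`AttrB1gPseudoGap`: the
rotation-odd subspace `eigenspace (toLin' Γ(r)) (-1)`; `TraceLemma`: `Γ(γ) ψ = ψ` for sector ground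
states), where `Γ(γ) := fockMapOp (d4Orb γ)` is the second quantisation (`FockMapOp.lean`) of the
orbital map `d4Orb γ` (`PairCorrelations.lean`: the dihedral group `D₄ = ⟨r, s⟩` acting on the
sites of the discrete torus `(ℤ/Lℤ)²` by the rotation `(a,b) ↦ (-b,a)` and the reflection
`(a,b) ↦ (a,-b)`, spin fixed). Everything is PROVED:

* `d4SiteEquiv γ : Equiv.Perm (TorusSite 2 L)` (inverse = action of `γ⁻¹`, from
  `d4Site_mul_holds`), and `d4Orb γ = ⇑(Orb.mapEquiv (FermionTorus.ofTorusEquiv (d4SiteEquiv γ)))`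
  DEFINITIONALLY (`d4Orb_eq_coe_mapEquiv`), so the `Orb.mapEquiv` theory of `FockMapOp` /
  `FermionRelabelling` applies verbatim to the route's `fockMapOp (d4Orb γ)`;
* `D₄` acts by AUTOMORPHISMS of the nearest-neighbour torus graph (`torusGraph_adj_d4Site_iff`:
  `rotSite`, `reflSite` are additive bijections permuting the steps `±e₀, ±e₁`), hence of
  `fermionTorusGraph 2 L` (`fermionTorusGraph_adj_d4`);
* consequences for `H_L = hubbardTorus 2 L t U`: `Γ(γ) H_L = H_L Γ(γ)`
  (`fockMapOp_d4Orb_mul_hubbardTorus`), `Γ(γ) N = N Γ(γ)`, `Γ(γ) S^z = S^z Γ(γ)`,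
  `Γ(γ) (szSector N M) ⊆ szSector N M`, `Γ(γ)` maps `(N, S^z = M)`-sector ground states to sector
  ground states (`IsGroundStateInSector.fockMapOp_d4Orb_mulVec`); `Γ(γ)` is unitary,
  `Γ(γ₁γ₂) = Γ(γ₁)Γ(γ₂)`, `Γ(1) = 1`, `Γ(γ)ᴴ = Γ(γ⁻¹)`, `Γ(r)⁴ = 1`;
* in Lieb's two-species coordinates: since `d4Orb γ = ⇑(Orb.mapEquiv e)` definitionally
  (`d4Orb_eq_coe_mapEquiv`, `e = FermionTorus.ofTorusEquiv (d4SiteEquiv γ)`), the law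
  `W(Γ(γ)ψ) = M_e W(ψ) M_eᵀ` with ONE signed permutation matrix and `Tr W(Γ(γ)ψ) = Tr W(ψ)` are
  `rw [d4Orb_eq_coe_mapEquiv]; exact liebW_fockMapOp_mapEquiv_mulVec e n ψ` (resp.
  `trace_liebW_fockMapOp_mapEquiv_mulVec`) from `FockMapOpLiebW.lean` (not imported here, to keep
  this file independent of the Lieb-theorem machinery).

## Design note (decidable equality on torus orbitals)

`Orb (FermionTorus 2 L) = Lex (Lex (Fin 2 → Fin L) × Fin 2)` carries two `DecidableEq`
instances that are not definitionally equal: the computable `Lex`/`Pi` one found by instance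
search, and the classical one underlying the (`Pi.Lex`) linear order used by the Jordan–Wigner
construction. Statements below that mention `1`, `^` or `Matrix.unitaryGroup` are therefore made
for an ARBITRARY `[DecidableEq (Finset (Orb (FermionTorus 2 L)))]`, so that they apply to the
instance appearing in the route text (`Matrix.toLin'`).

## References

* D. J. Scalapino, Phys. Rep. 250 (1995) 329, §2 (the point group `C₄ᵥ ≅ D₄` of the square
  lattice and the `d_{x²-y²}` channel). [Scalapino1995]
* F. H. L. Essler et al., *The One-Dimensional Hubbard Model*, CUP 2005, §2.2.2 (spatial
  symmetries of the Hubbard Hamiltonian as second-quantised site permutations; unitarity (2.42)).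
  [EsslerEtAl2005]
-/

noncomputable section

namespace Literature.MathematicalPhysics.QuantumLattice

open Matrix Finset

/-! ### The point group `D₄` of the square torus, second-quantised -/

section D4

open Literature.Probability.LatticeModels HubbardWave0

variable {L : ℕ}

/-- `γ⁻¹` undoes `γ` on torus sites (`d4Site` is a group action, `d4Site_mul_holds`).
[cite: Scalapino1995, §2] -/
theorem d4Site_inv_apply (γ : DihedralGroup 4) (x : TorusSite 2 L) : d4Site γ⁻¹ (d4Site γ x) = x := by
  rw [← d4Site_mul_holds γ⁻¹ γ x, inv_mul_cancel, d4Site_one]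

/-- `γ` undoes `γ⁻¹` on torus sites. [cite: Scalapino1995, §2] -/
theorem d4Site_apply_inv (γ : DihedralGroup 4) (x : TorusSite 2 L) : d4Site γ (d4Site γ⁻¹ x) = x := by
  rw [← d4Site_mul_holds γ γ⁻¹ x, mul_inv_cancel, d4Site_one]

/-- The action of `γ ∈ D₄` on the sites of the square torus as a permutation
(inverse: the action of `γ⁻¹`). [cite: Scalapino1995, §2] -/
def d4SiteEquiv (γ : DihedralGroup 4) : Equiv.Perm (TorusSite 2 L) where
  toFun := d4Site γ
  invFun := d4Site γ⁻¹
  left_inv := d4Site_inv_apply γ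
  right_inv := d4Site_apply_inv γ

/-- `d4SiteEquiv γ` acts as `d4Site γ`. [folklore] -/
@[simp] theorem d4SiteEquiv_apply (γ : DihedralGroup 4) (x : TorusSite 2 L) :
    d4SiteEquiv γ x = d4Site γ x := rfl

/-- **`d4Orb` is the orbital bijection of a site bijection**: the orbital map `d4Orb γ` of
`PairCorrelations` is (definitionally) `Orb.mapEquiv` of the fermionic-torus permutation induced
by `d4SiteEquiv γ`. [folklore] -/
theorem d4Orb_eq_coe_mapEquiv [NeZero L] (γ : DihedralGroup 4) :
    (d4Orb γ : Orb (FermionTorus 2 L) → Orb (FermionTorus 2 L)) =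
      ⇑(Orb.mapEquiv (FermionTorus.ofTorusEquiv (d4SiteEquiv (L := L) γ))) :=
  rfl

/-- `d4Orb γ` is a bijection of the orbitals. [cite: Scalapino1995, §2] -/
theorem d4Orb_bijective [NeZero L] (γ : DihedralGroup 4) :
    Function.Bijective (d4Orb γ : Orb (FermionTorus 2 L) → Orb (FermionTorus 2 L)) := by
  rw [d4Orb_eq_coe_mapEquiv]
  exact Equiv.bijective _

/-- The rotation by `π/2` is an automorphism of the nearest-neighbour torus graph (it permutes
the steps `±e₀, ±e₁`). [cite: Scalapino1995, §2] -/
theorem torusGraph_adj_rotSite {x y : TorusSite 2 L} (h : (torusGraph 2 L).Adj x y) :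
    (torusGraph 2 L).Adj (rotSite x) (rotSite y) := by
  rw [torusGraph_adj_iff] at h ⊢
  obtain ⟨hne, h⟩ := h
  refine ⟨fun h' => hne (rotSite_injective h'), ?_⟩
  have e0 : rotSite (Pi.single 0 1 : TorusSite 2 L) = Pi.single 1 1 := by
    funext i; fin_cases i <;> simp [rotSite]
  have e1 : rotSite (Pi.single 1 1 : TorusSite 2 L) = -Pi.single 0 1 := by
    funext i; fin_cases i <;> simp [rotSite]
  simp only [Fin.exists_fin_two] at h ⊢
  rcases h with (rfl | rfl) | (rfl | rfl)
  · exact Or.inl (Or.inr (by rw [rotSite_add, e0]))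
  · exact Or.inr (Or.inl (by rw [rotSite_add, e1, neg_add_cancel_right]))
  · exact Or.inr (Or.inr (by rw [rotSite_add, e0]))
  · exact Or.inl (Or.inl (by rw [rotSite_add, e1, neg_add_cancel_right]))

/-- The reflection in the `x`-axis is an automorphism of the nearest-neighbour torus graph.
[cite: Scalapino1995, §2] -/
theorem torusGraph_adj_reflSite {x y : TorusSite 2 L} (h : (torusGraph 2 L).Adj x y) :
    (torusGraph 2 L).Adj (reflSite x) (reflSite y) := by
  rw [torusGraph_adj_iff] at h ⊢
  obtain ⟨hne, h⟩ := h
  refine ⟨fun h' => hne (reflSite_injective h'), ?_⟩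
  have e0 : reflSite (Pi.single 0 1 : TorusSite 2 L) = Pi.single 0 1 := by
    funext i; fin_cases i <;> simp [reflSite]
  have e1 : reflSite (Pi.single 1 1 : TorusSite 2 L) = -Pi.single 1 1 := by
    funext i; fin_cases i <;> simp [reflSite]
  simp only [Fin.exists_fin_two] at h ⊢
  rcases h with (rfl | rfl) | (rfl | rfl)
  · exact Or.inl (Or.inl (by rw [reflSite_add, e0]))
  · exact Or.inr (Or.inr (by rw [reflSite_add, e1, neg_add_cancel_right]))
  · exact Or.inr (Or.inl (by rw [reflSite_add, e0]))
  · exact Or.inl (Or.inr (by rw [reflSite_add, e1, neg_add_cancel_right]))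

/-- Iterated rotations are graph automorphisms. [cite: Scalapino1995, §2] -/
theorem torusGraph_adj_rotSite_iterate (n : ℕ) {x y : TorusSite 2 L} (h : (torusGraph 2 L).Adj x y) :
    (torusGraph 2 L).Adj (rotSite^[n] x) (rotSite^[n] y) := by
  induction n with
  | zero => exact h
  | succ n ih =>
      rw [Function.iterate_succ_apply', Function.iterate_succ_apply']
      exact torusGraph_adj_rotSite ih

/-- Every `γ ∈ D₄` maps adjacent torus sites to adjacent sites. [cite: Scalapino1995, §2] -/
theorem torusGraph_adj_d4Site (γ : DihedralGroup 4) {x y : TorusSite 2 L}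
    (h : (torusGraph 2 L).Adj x y) : (torusGraph 2 L).Adj (d4Site γ x) (d4Site γ y) := by
  rcases γ with i | i
  · exact torusGraph_adj_rotSite_iterate i.val h
  · exact torusGraph_adj_reflSite (torusGraph_adj_rotSite_iterate i.val h)

/-- **`D₄` acts by automorphisms of the nearest-neighbour graph of the square torus.**
[cite: Scalapino1995, §2] -/
theorem torusGraph_adj_d4Site_iff (γ : DihedralGroup 4) (x y : TorusSite 2 L) :
    (torusGraph 2 L).Adj (d4Site γ x) (d4Site γ y) ↔ (torusGraph 2 L).Adj x y := by
  refine ⟨fun h => ?_, torusGraph_adj_d4Site γ⟩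
  have h' := torusGraph_adj_d4Site γ⁻¹ h
  rwa [d4Site_inv_apply, d4Site_inv_apply] at h'

/-- The induced permutation of the fermionic torus is an automorphism of `fermionTorusGraph 2 L`.
[cite: Scalapino1995, §2] -/
theorem fermionTorusGraph_adj_d4 [NeZero L] (γ : DihedralGroup 4) (x y : FermionTorus 2 L) :
    (fermionTorusGraph 2 L).Adj (FermionTorus.ofTorusEquiv (d4SiteEquiv γ) x)
        (FermionTorus.ofTorusEquiv (d4SiteEquiv γ) y) ↔ (fermionTorusGraph 2 L).Adj x y := by
  rw [fermionTorusGraph_adj, fermionTorusGraph_adj, FermionTorus.toTorusSite_ofTorusEquiv,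
    FermionTorus.toTorusSite_ofTorusEquiv, d4SiteEquiv_apply, d4SiteEquiv_apply]
  exact torusGraph_adj_d4Site_iff γ _ _

variable [NeZero L]

/-- **The second-quantised point group is a symmetry of the Hubbard torus**:
`Γ(γ) H_L(t,U) = H_L(t,U) Γ(γ)` for `Γ(γ) = fockMapOp (d4Orb γ)`. [cite: Scalapino1995, §2] -/
theorem fockMapOp_d4Orb_mul_hubbardTorus (γ : DihedralGroup 4) (t U : ℝ) :
    fockMapOp (d4Orb γ) * hubbardTorus 2 L t U = hubbardTorus 2 L t U * fockMapOp (d4Orb γ) :=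
  fockMapOp_mapEquiv_mul_hamiltonian (fermionTorusGraph 2 L) (fermionTorusGraph 2 L)
    (FermionTorus.ofTorusEquiv (d4SiteEquiv γ)) (fermionTorusGraph_adj_d4 γ) t U

/-- `Γ(γ)` commutes with the particle number. [folklore] -/
theorem fockMapOp_d4Orb_mul_totalNumber (γ : DihedralGroup 4) :
    fockMapOp (d4Orb γ) * (totalNumber : Matrix _ (Finset (Orb (FermionTorus 2 L))) ℂ) =
      totalNumber * fockMapOp (d4Orb γ) :=
  fockMapOp_mapEquiv_mul_totalNumber (FermionTorus.ofTorusEquiv (d4SiteEquiv (L := L) γ))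

/-- `Γ(γ)` commutes with `S^z`. [folklore] -/
theorem fockMapOp_d4Orb_mul_spinZ (γ : DihedralGroup 4) :
    fockMapOp (d4Orb γ) * (spinZ : Matrix _ (Finset (Orb (FermionTorus 2 L))) ℂ) =
      spinZ * fockMapOp (d4Orb γ) :=
  fockMapOp_mapEquiv_mul_spinZ (FermionTorus.ofTorusEquiv (d4SiteEquiv (L := L) γ))

/-- `Γ(γ)` preserves the joint sectors `(N, S^z = M)` of the torus. [folklore] -/
theorem fockMapOp_d4Orb_mulVec_mem_szSector (γ : DihedralGroup 4) {N : ℕ} {M : ℝ}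
    {ψ : Fock (Orb (FermionTorus 2 L))} (hψ : ψ ∈ szSector N M) :
    fockMapOp (d4Orb γ) *ᵥ ψ ∈ szSector (Λ := FermionTorus 2 L) N M :=
  fockMapOp_mapEquiv_mulVec_mem_szSector (FermionTorus.ofTorusEquiv (d4SiteEquiv γ)) hψ

/-- `Γ(γ)` is unitary (for any `DecidableEq` instance used to form the unitary group: on
`Orb (FermionTorus 2 L)` the `Lex`/`Pi` instance and the one underlying the linear order differ).
[cite: EsslerEtAl2005, §2.2.2 eq. (2.42)] -/
theorem fockMapOp_d4Orb_mem_unitaryGroup [DecidableEq (Finset (Orb (FermionTorus 2 L)))]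
    (γ : DihedralGroup 4) :
    fockMapOp (d4Orb γ) ∈ Matrix.unitaryGroup (Finset (Orb (FermionTorus 2 L))) ℂ := by
  rw [Matrix.mem_unitaryGroup_iff, star_eq_conjTranspose]
  convert fockMapOp_mul_conjTranspose_self _ (d4Orb_bijective (L := L) γ) using 4 <;> rfl

/-- **`γ ↦ Γ(γ)` is a representation of `D₄`**: `Γ(γ₁ γ₂) = Γ(γ₁) Γ(γ₂)` (functoriality and
`d4Orb_mul_holds`). [cite: Scalapino1995, §2] -/
theorem fockMapOp_d4Orb_mul (γ₁ γ₂ : DihedralGroup 4) :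
    fockMapOp (d4Orb (γ₁ * γ₂) : Orb (FermionTorus 2 L) → _) =
      fockMapOp (d4Orb γ₁) * fockMapOp (d4Orb γ₂) := by
  rw [← fockMapOp_comp]
  congr 1
  funext o
  exact d4Orb_mul_holds γ₁ γ₂ o

/-- `d4Orb 1 = id`. [folklore] -/
theorem d4Orb_one : (d4Orb (1 : DihedralGroup 4) : Orb (FermionTorus 2 L) → _) = id := by
  funext o
  simp only [d4Orb, d4Site_one, FermionTorus.ofTorusSite_toTorusSite, id_eq]
  rfl

/-- `Γ(1) = 1` (for any `DecidableEq` instance used to form the identity matrix). [folklore] -/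
theorem fockMapOp_d4Orb_one [DecidableEq (Finset (Orb (FermionTorus 2 L)))] :
    fockMapOp (d4Orb (1 : DihedralGroup 4) : Orb (FermionTorus 2 L) → _) = 1 := by
  rw [d4Orb_one]
  convert fockMapOp_id (ι := Orb (FermionTorus 2 L))

/-- `Γ(γ)ᴴ = Γ(γ⁻¹)` (`= Γ(γ)⁻¹`). [folklore] -/
theorem conjTranspose_fockMapOp_d4Orb (γ : DihedralGroup 4) :
    (fockMapOp (d4Orb γ : Orb (FermionTorus 2 L) → _))ᴴ = fockMapOp (d4Orb γ⁻¹) :=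
  conjTranspose_fockMapOp (Orb.mapEquiv (FermionTorus.ofTorusEquiv (d4SiteEquiv (L := L) γ)))

/-- The rotation operator has order four: `Γ(r)⁴ = 1`. [cite: Scalapino1995, §2] -/
theorem fockMapOp_d4Orb_r_one_pow_four [DecidableEq (Finset (Orb (FermionTorus 2 L)))] :
    fockMapOp (d4Orb (DihedralGroup.r 1 : DihedralGroup 4) : Orb (FermionTorus 2 L) → _) ^ 4 = 1 := by
  rw [pow_succ, pow_succ, pow_succ, pow_one, ← fockMapOp_d4Orb_mul, ← fockMapOp_d4Orb_mul,
    ← fockMapOp_d4Orb_mul]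
  have h : (DihedralGroup.r 1 : DihedralGroup 4) * DihedralGroup.r 1 * DihedralGroup.r 1 *
      DihedralGroup.r 1 = 1 := by decide
  rw [h, fockMapOp_d4Orb_one]

/-- **Point-group symmetry of sector ground states**: `Γ(γ)` maps every `(N, S^z = M)`-sector
ground state of the Hubbard torus to a ground state of the same sector (and energy).
[cite: Scalapino1995, §2] -/
theorem IsGroundStateInSector.fockMapOp_d4Orb_mulVec (γ : DihedralGroup 4) {t U : ℝ} {N : ℕ}
    {M : ℝ} {ψ : Fock (Orb (FermionTorus 2 L))}
    (hψ : IsGroundStateInSector (hubbardTorus 2 L t U) N M ψ) :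
    IsGroundStateInSector (hubbardTorus 2 L t U) N M (fockMapOp (d4Orb γ) *ᵥ ψ) :=
  IsGroundStateInSector.fockMapOp_mapEquiv_mulVec (fermionTorusGraph 2 L)
    (FermionTorus.ofTorusEquiv (d4SiteEquiv γ)) (fermionTorusGraph_adj_d4 γ) hψ

end D4

end Literature.MathematicalPhysics.QuantumLattice
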